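import Mathlib
import Summits.ValiantsHypothesis.ValiantsHypothesis.Theses.NumTame

/-!
# Birth skeleton (BC3) for crux `NumTame.TameA3`
# (stmt-ValiantsHypothesis-5386, route-ValiantsHypothesis-NumTame; skeleton-register, gen 1)

Crux decl `Summit.ValiantsHypothesis.ValiantsHypothesis.Theses.NumTame.TameA3` (rank 3, "archimedean
(A3), GRH-free"): if `φ_n : {0,1}^n → ℕ`, `φ_n < 2^{t(n)}`, `t` p-bounded, is computed on the cube by
fan-in-two `ℂ`-circuits of p-bounded size `r(n)` whose constants, sum weights, output constant and
gate cube-values all have modulus `≤ 2^{r(n)}`, then the bits of `φ_n` have polynomial-size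
`B₂`-circuits (`∃ q : ℕ[X], ∀ n, CktSize B2 (x i ↦ (φ n x).testBit i) (q.eval n)`).

## The line: the route's own two-layer plan `TameA3 ⇐ FixedPointGates → ErrorRecursion → TameA3`

The route header (TWO-LAYER PLAN; NUMBERS: "B = (R+2)(s+1)+10 fractional bits … error
ε_j ≤ (2^(R+2))^(j+1)·2^(-B) < 1/4; Boolean cost O(s·(R+B)^2)") and both stamps on the item
(refuter g42-8: "simulate gate list in complex fixed point with B fractional bits … rounded
constants/weights are advice … φ_n(x) = round(Re(output))"; grounder g16-13: "a clean
error-recursion lemma over ArithCircuit.gateValues + Boolean-circuit engineering") describe ONE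
mechanism with two disjoint halves — numerical analysis and circuit engineering.  To state the
halves as lemmas one needs the object they share, which the tree lacks (Mathlib/Literature have no
bit-model simulation of straight-line programs): the **clamped complex fixed-point semantics** of an
`ArithCircuit ℂ σ` at a Boolean point, `FixedPoint.evalFx P I B x : GaussianInt` (format: `I`
integer bits, `B` fractional bits; a Gaussian integer `z` stands for `z / 2^B`; constants and
weights enter rounded to the grid, products are rescaled by an arithmetic right shift `rshift B`
(floor), and EVERY produced value passes through the overflow clamp `clamp (I+B)` (out of range ↦
`0`), so all values of a run have components in `(-2^(I+B), 2^(I+B))` unconditionally), and its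
rounded output `FixedPoint.outNat P I B x = ⌊Re(evalFx)/2^B + 1/2⌋⁺ : ℕ`.  Over this object:

* `stub_rounding` (ERROR RECURSION; the analysis half; size M–L): for some absolute `c`, for every
  fan-in-two circuit `P` of size `s` that is `2^R`-tame AT the point `x` (constants, sum weights,
  output constant of modulus `≤ 2^R`, every gate's exact value at `x` of modulus `≤ 2^R`) and every
  precision `B ≥ (R + s + 2)^c`, the run in format `(R + 2, B)` tracks the exact run:
  `‖evalFx/2^B − eval (boolPoint x) P.eval‖ < 1/2`.  (Induction over the gate list with the
  invariant `ε_j ≤ 2^((R+3)(j+1)) · 2^(-B) ≤ 1`, which also shows that no clamp ever fires: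
  `|value| ≤ 2^R + 1 < 2^(R+2)`; operand errors: variables exact, constants `≤ 2^(-B)`, floor
  shifts `< √2 · 2^(-B)`; sum gate `≤ 2(2^R+1)ε + O(2^R 2^(-B))`, product gate
  `≤ (2^(R+1)+1)ε + √2·2^(-B)`; fan-in two is essential and is a hypothesis.)
* `stub_gates` (FIXED-POINT GATES; the Boolean-engineering half; size L): for some absolute `c`,
  for EVERY fan-in-two circuit `P` (no tameness needed — the clamp bounds every word) and all
  `I B w`, the map `x ↦ (bits 0 … w-1 of outNat P I B x)` has `B₂`-circuits of size
  `≤ (s + I + B + w + 2)^c` (per gate: ≤ 2 complex fixed-width multiplications of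
  `(I+B+1)`-bit signed words = schoolbook `cktSize_mulBits`/`cktSize_addBits` of
  `CircuitAdderMultiplier.lean` plus sign handling, a shift = rewiring, a clamp = two comparators and
  a multiplexer (`cktSize_mux`); rounded constants are hard-wired advice; composition by
  `CktSize.comp/pair`; unused inputs are free, so `n` does not enter).
* `TameA3_of` — the composition, kernel-checked and sorry-free: given the tame family with bound
  `r`, take `R := r n`, format `(r n + 2, B n)` with `B n := (2 r n + 2)^c₁ ≥ (R + s + 2)^c₁`;
  `stub_rounding` + `P` computes `φ n` on the cube give `‖evalFx/2^B − φ n x‖ < 1/2`, whence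
  `outNat = φ n x` (`FixedPoint.toNat_round_eq`, proved here: nearest-integer rounding of the real
  part via `Int.ediv`); `stub_gates` at width `w := t n` gives the `B₂`-program, `CktSize.congr`
  swaps in `φ`, and the size `(s + (R+2) + B + t n + 2)^c₂ ≤ g n` with
  `g n = (r n + (r n + 2) + (2 r n + 2)^c₁ + t n + 2)^c₂` p-bounded (`IsPBounded.add/pow_holds`),
  so `isPBounded_iff_exists_polynomial_holds` yields the polynomial `q` (`CktSize.of_le`).

Neither stub is comparable to the crux or to the summit by a cheap implication: `stub_rounding` has
no Boolean circuits in it and `stub_gates` no link between `outNat` and `φ`; BC3 probes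
`stub → TameA3`, `stub → ValiantsHypothesis` by `first | exact? | simpa | aesop` FAIL for both (and
for the unfolded variants; converses fail too) — registrar's NOTES.md / `Lines/birth.md`.  The cut is
not a shred: the two stubs are the two areas the route imports (numerical analysis of straight-line
programs — Koiran's weak model doi:10.1006/jcss.1997.1478, Cucker–Grigoriev
doi:10.1137/s0097539794270340, BCSS 1998; fixed-width arithmetic circuits — Vollmer 1999 §1.3,
Wegener 1987 Ch. 3), and the seam (`TameA3_of`) carries the rounding-to-integer step and all the
p-boundedness bookkeeping.

## Shape (skeleton audit by-name rule, as in `Cruxes/BinomialCandidate/Lines/birth.lean`)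
* `FixedPoint.*` — the shared object (8 small definitions, total semantics mirroring
  `ArithCircuit.gateValues`/`Operand.eval`: junk gate references read `0` in both);
* `Stmt.stub_rounding`, `Stmt.stub_gates` — the two stub statements as `Prop`s, named like the stubs;
* `stub_rounding`, `stub_gates` — the same statements as sorried theorems (the REGISTERED stubs;
  `sorry` occurs nowhere else);
* `TameA3_of : Stmt.stub_rounding → Stmt.stub_gates → TameA3` — real proof; the closing `example`
  ties the two copies (`TameA3_of stub_rounding stub_gates : TameA3`).
A prover landing a stub as `Theorems/NumTameTameA3<Stub>.lean --supports stmt-ValiantsHypothesis-5386`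
imports this file for the `FixedPoint` definitions (or re-homes them in a support file first).

**Disproof used.** None exists: `Cruxes/TameA3/` had no workfiles (no `Disproof.lean`, no
`_false_without_` theorem, no `Negative/` lemma) at registration (2026-08-17), and
`ledger negatives --problem ValiantsHypothesis` (4 entries: UlrichPadded, ElusiveCandidate, …) has
nothing on Boolean parts, rounding or fixed-point simulation, so no stub is an instance a landed
negative lemma refutes.  The refuter's hypothesis-mutation notes are honoured: the weight bound, the
output-constant bound, the cube-value bound and fan-in two are all hypotheses of `stub_rounding`
(dropping any one breaks the error recursion), while `stub_gates` needs none of them because the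
clamp makes every run bounded.  Hardest stub: `stub_gates` (pure engineering volume); the
mathematically delicate one is `stub_rounding` (clamp-inactivity must ride along the induction).
-/

set_option linter.dupNamespace false

noncomputable section

namespace Summit.ValiantsHypothesis.ValiantsHypothesis.Cruxes.TameA3.Birth

open Summit.ValiantsHypothesis.ValiantsHypothesis.Theses.NumTame
open Literature.Computability.AlgebraicComplexity
open Literature.Computability.Complexity (CktSize B2)

/-! ## Clamped complex fixed-point semantics of an arithmetic circuit (format `I` integer bits,
`B` fractional bits; every value is a Gaussian integer `z` standing for `z / 2^B`) -/

namespace FixedPoint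

open ArithCircuit

/-- Overflow clamp of the format: keep `z` if both components lie in `(-2^M, 2^M)`, else `0`. -/
def clamp (M : ℕ) (z : GaussianInt) : GaussianInt :=
  if |z.re| < 2 ^ M ∧ |z.im| < 2 ^ M then z else 0

/-- Arithmetic right shift by `B` bits in both components (floor division by `2^B`). -/
def rshift (B : ℕ) (z : GaussianInt) : GaussianInt :=
  ⟨z.re / 2 ^ B, z.im / 2 ^ B⟩

/-- The nearest point of the grid `2^{-B} ℤ[i]` to `a`, as its numerator. -/
def ofComplex (B : ℕ) (a : ℂ) : GaussianInt :=
  ⟨round (a.re * 2 ^ B), round (a.im * 2 ^ B)⟩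

variable {σ : Type*}

/-- Fixed-point value of an operand (junk gate references read `0`, as in `Operand.eval`). -/
def operandFx (I B : ℕ) (x : σ → Bool) (vals : List GaussianInt) : Operand ℂ σ → GaussianInt
  | .var i => if x i then clamp (I + B) (2 ^ B) else 0
  | .const a => clamp (I + B) (ofComplex B a)
  | .gate j => vals.getD j 0

/-- Fixed-point value of a gate: rounded weights, products rescaled by `rshift B`, every result
clamped to the format. -/
def gateFx (I B : ℕ) (x : σ → Bool) (vals : List GaussianInt) : Gate ℂ σ → GaussianInt
  | .sum args => clamp (I + B)
      ((args.map fun a => rshift B (clamp (I + B) (ofComplex B a.1) * operandFx I B x vals a.2)).sum)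
  | .prod args => args.foldl
      (fun acc u => clamp (I + B) (rshift B (acc * operandFx I B x vals u))) (clamp (I + B) (2 ^ B))

/-- Fixed-point values of a gate list (left fold, as `gateValues`). -/
def gateValuesFx (I B : ℕ) (x : σ → Bool) (gs : List (Gate ℂ σ)) : List GaussianInt :=
  gs.foldl (fun vals g => vals ++ [gateFx I B x vals g]) []

/-- Fixed-point value of the output operand of `P` at the Boolean point `x`. -/
def evalFx (P : ArithCircuit ℂ σ) (I B : ℕ) (x : σ → Bool) : GaussianInt :=
  operandFx I B x (gateValuesFx I B x P.gates) P.output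

/-- The simulated output rounded to the nearest natural number: `⌊Re(evalFx)/2^B + 1/2⌋⁺`. -/
def outNat (P : ArithCircuit ℂ σ) (I B : ℕ) (x : σ → Bool) : ℕ :=
  Int.toNat ((2 * (evalFx P I B x).re + 2 ^ B) / 2 ^ (B + 1))

end FixedPoint

/-! ## The two stub statements -/

/-- STUB 1 — ERROR RECURSION (`ErrorRecursion` of the route's two-layer plan; OPEN, size M–L).
For some absolute `c`: for every fan-in-two circuit `P` over `ℂ` in `n` variables, every Boolean
point `x`, every magnitude exponent `R` such that all constants (operands `const a` of gates), all
sum weights, the output constant and ALL exact gate values at `x` have modulus `≤ 2^R`, and every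
precision `B ≥ (R + P.size + 2)^c`, the clamped fixed-point run in format `(R + 2, B)` is within
`1/2` of the exact output value: `‖evalFx P (R+2) B x / 2^B − eval (boolPoint ℂ x) P.eval‖ < 1/2`.
Why plausibly true: forward error analysis, `ε_j ≤ 2^((R+3)(j+1))·2^(-B)` by induction over the
gate list (route NUMBERS; refuter g42-8 / grounder g16-13 paper proofs), the same induction showing
every value stays below `2^R + 1 < 2^(R+2)` so that no clamp fires.  Why it might fail: only through
a mismatch between this file's `FixedPoint` semantics and `ArithCircuit.gateValues` (junk references,
empty sums/products, operand order) — all mirrored definitionally; mathematically it is the textbook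
bit-model simulation (Koiran 1997 doi:10.1006/jcss.1997.1478; BCSS 1998; Allender et al. 2009
doi:10.1137/070697926). -/
def Stmt.stub_rounding : Prop :=
  ∃ c : ℕ, ∀ (n R B : ℕ) (P : ArithCircuit ℂ (Fin n)) (x : Fin n → Bool),
    P.IsFanInTwo →
    (∀ g ∈ P.gates, ∀ u ∈ ArithCircuit.Gate.args g, ∀ a : ℂ,
      u = ArithCircuit.Operand.const a → ‖a‖ ≤ (2 : ℝ) ^ R) →
    (∀ args, ArithCircuit.Gate.sum args ∈ P.gates → ∀ a ∈ args, ‖a.1‖ ≤ (2 : ℝ) ^ R) →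
    (∀ a : ℂ, P.output = ArithCircuit.Operand.const a → ‖a‖ ≤ (2 : ℝ) ^ R) →
    (∀ g ∈ ArithCircuit.gateValues P.gates, ‖MvPolynomial.eval (boolPoint ℂ x) g‖ ≤ (2 : ℝ) ^ R) →
    (R + P.size + 2) ^ c ≤ B →
    ‖GaussianInt.toComplex (FixedPoint.evalFx P (R + 2) B x) / (2 : ℂ) ^ B
        - MvPolynomial.eval (boolPoint ℂ x) P.eval‖ < 1 / 2

/-- STUB 2 — FIXED-POINT GATES (`FixedPointGates` of the route's two-layer plan; OPEN, size L).
For some absolute `c`: for EVERY fan-in-two circuit `P` over `ℂ` in `n` variables (no magnitude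
hypotheses: the clamp keeps every word of the run inside `(I+B+1)`-bit signed range) and all
`I B w`, the Boolean map `x ↦ (bit i of outNat P I B x)_{i<w}` is computed by a `B₂`-circuit with at
most `(P.size + I + B + w + 2)^c` gates.  Why plausibly true: each gate is ≤ 2 fixed-width complex
multiply–shift–clamp steps on `O(I+B)`-bit words (schoolbook multiplier/adder
`ArithCkt.cktSize_mulBits`/`cktSize_addBits`, multiplexer `cktSize_mux`, comparators), rounded
constants are hard-wired, composition is `CktSize.comp`/`pair`, the final rounding
`⌊(2·re + 2^B)/2^(B+1)⌋⁺` is an adder and a shift, output bits beyond the word are the constant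
`false`; inputs not read cost nothing, so `n` does not enter the bound (Vollmer 1999 §1.3 Thm 1.23;
Wegener 1987 Ch. 3).  Why it might fail: not mathematically — the risk is formal volume (signed
arithmetic: two's complement makes `rshift` = drop low bits and needs sign-extension before
`mulBits`; sign–magnitude needs a compare-and-subtract adder). -/
def Stmt.stub_gates : Prop :=
  ∃ c : ℕ, ∀ (n I B w : ℕ) (P : ArithCircuit ℂ (Fin n)), P.IsFanInTwo →
    CktSize B2 (fun (x : Fin n → Bool) (i : Fin w) => (FixedPoint.outNat P I B x).testBit i)
      ((P.size + I + B + w + 2) ^ c)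

/-! ## Registered stubs (the ONLY sorries of this file) -/

/-- Registered stub 1 = `Stmt.stub_rounding` verbatim (error recursion for the clamped fixed-point
run of a tame fan-in-two circuit). [doi:10.1006/jcss.1997.1478, BlumCuckerShubSmale1998,
doi:10.1137/070697926, Burgisser2000TCS] -/
theorem stub_rounding :
    ∃ c : ℕ, ∀ (n R B : ℕ) (P : ArithCircuit ℂ (Fin n)) (x : Fin n → Bool),
      P.IsFanInTwo →
      (∀ g ∈ P.gates, ∀ u ∈ ArithCircuit.Gate.args g, ∀ a : ℂ,
        u = ArithCircuit.Operand.const a → ‖a‖ ≤ (2 : ℝ) ^ R) →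
      (∀ args, ArithCircuit.Gate.sum args ∈ P.gates → ∀ a ∈ args, ‖a.1‖ ≤ (2 : ℝ) ^ R) →
      (∀ a : ℂ, P.output = ArithCircuit.Operand.const a → ‖a‖ ≤ (2 : ℝ) ^ R) →
      (∀ g ∈ ArithCircuit.gateValues P.gates, ‖MvPolynomial.eval (boolPoint ℂ x) g‖ ≤ (2 : ℝ) ^ R) →
      (R + P.size + 2) ^ c ≤ B →
      ‖GaussianInt.toComplex (FixedPoint.evalFx P (R + 2) B x) / (2 : ℂ) ^ B
          - MvPolynomial.eval (boolPoint ℂ x) P.eval‖ < 1 / 2 := by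
  sorry

/-- Registered stub 2 = `Stmt.stub_gates` verbatim (polynomial-size `B₂`-circuits for the clamped
fixed-point run). [Vollmer1999 §1.3, Wegener1987 Ch. 3; tree: CircuitAdderMultiplier.lean,
CircuitComposition.lean] -/
theorem stub_gates :
    ∃ c : ℕ, ∀ (n I B w : ℕ) (P : ArithCircuit ℂ (Fin n)), P.IsFanInTwo →
      CktSize B2 (fun (x : Fin n → Bool) (i : Fin w) => (FixedPoint.outNat P I B x).testBit i)
        ((P.size + I + B + w + 2) ^ c) := by
  sorry

/-! ## The composition (kernel-checked, sorry-free) -/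

/-- Rounding lemma (part of the seam, proved): if the fixed-point number `z / 2^B` is within `1/2`
of a natural number `m` (in complex norm), then rounding its real part to the nearest integer,
`⌊(2·z.re + 2^B) / 2^(B+1)⌋⁺`, returns `m`. [folklore] -/
theorem FixedPoint.toNat_round_eq {z : GaussianInt} {B m : ℕ}
    (h : ‖GaussianInt.toComplex z / (2 : ℂ) ^ B - (m : ℂ)‖ < 1 / 2) :
    Int.toNat ((2 * z.re + 2 ^ B) / 2 ^ (B + 1)) = m := by
  have hre : (GaussianInt.toComplex z / (2 : ℂ) ^ B - (m : ℂ)).re = (z.re : ℝ) / (2 : ℝ) ^ B - m := by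
    have h2 : (2 : ℂ) ^ B = ((2 ^ B : ℕ) : ℂ) := by push_cast; rfl
    rw [Complex.sub_re, h2, Complex.div_natCast_re, ← GaussianInt.intCast_re, Complex.natCast_re]
    push_cast
    rfl
  have habs : |(z.re : ℝ) / (2 : ℝ) ^ B - m| < 1 / 2 := by
    rw [← hre]
    exact (Complex.abs_re_le_norm _).trans_lt h
  have hpos : (0 : ℝ) < (2 : ℝ) ^ B := by positivity
  rw [abs_lt] at habs
  obtain ⟨h1, h2⟩ := habs
  have h1' : (m : ℝ) * 2 ^ (B + 1) < 2 * z.re + 2 ^ B := by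
    rw [pow_succ]
    have := (lt_sub_iff_add_lt).1 h1
    have key : ((m : ℝ) - 1 / 2) * 2 ^ B < (z.re : ℝ) := by
      rw [← lt_div_iff₀ hpos]; linarith
    nlinarith
  have h2' : (2 * z.re + 2 ^ B : ℝ) < ((m : ℝ) + 1) * 2 ^ (B + 1) := by
    rw [pow_succ]
    have key : (z.re : ℝ) < ((m : ℝ) + 1 / 2) * 2 ^ B := by
      rw [← div_lt_iff₀ hpos]; linarith
    nlinarith
  have i1 : (m : ℤ) * 2 ^ (B + 1) < 2 * z.re + 2 ^ B := by exact_mod_cast h1'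
  have i2 : 2 * z.re + 2 ^ B < ((m : ℤ) + 1) * 2 ^ (B + 1) := by exact_mod_cast h2'
  have hq : (2 * z.re + 2 ^ B) / 2 ^ (B + 1) = (m : ℤ) := by
    have hp : (0 : ℤ) < 2 ^ (B + 1) := by positivity
    apply le_antisymm
    · have := (Int.ediv_lt_iff_lt_mul hp).2 i2
      omega
    · exact (Int.le_ediv_iff_mul_le hp).2 i1.le
  rw [hq, Int.toNat_natCast]

/-- **The crux from the two stubs** (composition; conclusion literally the route decl
`Summit.ValiantsHypothesis.ValiantsHypothesis.Theses.NumTame.TameA3`).  Precision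
`B n = (2 r n + 2)^c₁`, format `(r n + 2, B n)`; Stage 1 (`stub_rounding` + `toNat_round_eq`): the
run rounds to `φ n x` exactly; Stage 2 (`stub_gates` at width `t n`): it is a `B₂`-program of size
`(s + r n + 2 + B n + t n + 2)^c₂ ≤ g n ≤ q.eval n` with `g` p-bounded. [folklore] -/
theorem TameA3_of : Stmt.stub_rounding → Stmt.stub_gates → TameA3 := by
  rintro ⟨c₁, hround⟩ ⟨c₂, hgates⟩ φ t ht hφ ⟨r, hr, hP⟩
  -- the global size bound, p-bounded in `n`
  have hg : IsPBounded fun n => (r n + (r n + 2) + (r n + r n + 2) ^ c₁ + t n + 2) ^ c₂ :=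
    IsPBounded.pow_holds (IsPBounded.add_holds (IsPBounded.add_holds (IsPBounded.add_holds
      (IsPBounded.add_holds hr (IsPBounded.add_holds hr (IsPBounded.const 2)))
      (IsPBounded.pow_holds (IsPBounded.add_holds (IsPBounded.add_holds hr hr) (IsPBounded.const 2)) c₁))
      ht) (IsPBounded.const 2)) c₂
  obtain ⟨q, hq⟩ := (isPBounded_iff_exists_polynomial_holds _).1 hg
  refine ⟨q, fun n => ?_⟩
  obtain ⟨P, hsize, hfan, hconst, hwt, hout, hval, hcomp⟩ := hP n
  -- precision
  set B : ℕ := (r n + r n + 2) ^ c₁ with hB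
  have hprec : (r n + P.size + 2) ^ c₁ ≤ B := Nat.pow_le_pow_left (by omega) _
  -- Stage 1 (stub_rounding): the clamped fixed-point run in format (r n + 2, B) rounds to φ n x
  have hexact : ∀ x : Fin n → Bool, FixedPoint.outNat P (r n + 2) B x = φ n x := fun x => by
    have h := hround n (r n) B P x hfan hconst hwt hout (fun g hg => hval g hg x) hprec
    rw [hcomp x] at h
    exact FixedPoint.toNat_round_eq h
  -- Stage 2 (stub_gates): that run is a polynomial-size B₂ program
  have hck := hgates n (r n + 2) B (t n) P hfan
  refine CktSize.of_le (hck.congr fun x i => by rw [hexact x]) (le_trans ?_ (hq n))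
  exact Nat.pow_le_pow_left (by omega) _

/-- Wiring check: the registered stubs feed `TameA3_of` exactly as stated, so the skeleton is
`TameA3` closed modulo exactly the two registered stubs (sorries enter only through them). -/
example : TameA3 := TameA3_of stub_rounding stub_gates

end Summit.ValiantsHypothesis.ValiantsHypothesis.Cruxes.TameA3.Birth

end
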